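import Literature.IUT.LogVolume.Corollary22LegendreDeepAdmissiblePairs
import HarnessLib

/-!
# HEX-KERNEL (H5, arithmetic core): the degree-form depth inequality HOLDS at the top label for `p = 7`, `‖t_q‖ ≤ 7^{−k/l}`,
# `[K : ℚ] ≤ 184320·l⁴`, `11 ≤ l ≤ 60·k`, `k` large

Pure real arithmetic (classical; nothing disputed) for abc-iut branch C's assembly (seat abc-iut-C-cert-1, writer of record of the
S_H line `abc_of_SH_v6K`; bricks (H0) abc-iut-w5-d044 `Cor22.exists_admissible_prime_ratPoint_lamSeven` / `exists_nat_forall_affine_log_le`,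
(H1) abc-iut-w5-d194 `ThetaVolumeDatumAt.finrank_rat_K_le_ratPoint`, (H2)/(H3) `depthConstants_lt` / `not_hSH_v6K_of_exists_degree_deep`,
(H4) abc-iut-w4-d026 / abc-iut-c312-7 (norm of the chosen realising q-idele), (H6) abc-iut-w4-d098 (bad places over the deep prime)).
The premise of `Summit.ABC.IUTFork.Conditional.not_hSH_v6K_of_exists_degree_deep` at the data «`p = 7`, label `j = (l−1)/2 = l⋆`,
`‖t_{q,x₀}‖ ≤ 7^{−k/l}`, `[T.K : ℚ] ≤ 184320·l⁴`» is the real inequality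

  `7^{((i+2)·(4 + 2·log₇ N) + 1)} · ‖t‖^{(i+1)²−1} < 1`,  `i + 1 = (l−1)/2`,

and this file proves it for all `k ≥ k₁` (an absolute constant from `exists_nat_forall_affine_log_le 52.25 22 60`), all odd `l` with
`11 ≤ l ≤ 60·k`, all `1 ≤ N ≤ 184320·l⁴` and every real `0 ≤ ‖t‖ ≤ 7^{−k/l}` (`Hex.core_ineq`). Arithmetic: with `j = (l−1)/2`,
`(j²−1) = (j−1)(j+1)`, `(k/l)(j−1) = k(l−3)/(2l) ≥ 4k/11`, `log₇ N < 7 + 4·log₇ l ≤ 7 + 4·log l` (`184320 < 7⁷`, `log 7 ≥ 1`), and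
`4k/11 ≥ 19 + 8·log l` from `52.25 + 22·log l ≤ k`.
-/

noncomputable section

namespace Summit.ABC.IUTFork.Conditional.Hex

open Real Literature.IUT.LogVolume.Cor22

/-- `log 7 ≥ 1` (`e < 2.72 < 7`). [folklore] -/
theorem one_le_log_seven : (1 : ℝ) ≤ Real.log 7 := by
  rw [← Real.log_exp 1]
  apply Real.log_le_log (Real.exp_pos 1)
  have := Real.exp_one_lt_d9
  linarith

/-- `log₇ 184320 < 7` (`184320 < 7⁷ = 823543`). [folklore] -/
theorem logb_seven_const_lt : Real.logb 7 (184320 : ℝ) < 7 := by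
  have h7 : (1 : ℝ) < 7 := by norm_num
  have : (184320 : ℝ) < 7 ^ (7 : ℝ) := by
    rw [show (7 : ℝ) ^ (7 : ℝ) = (7 : ℝ) ^ (7 : ℕ) by exact_mod_cast Real.rpow_natCast 7 7]
    norm_num
  calc Real.logb 7 184320 < Real.logb 7 ((7 : ℝ) ^ (7 : ℝ)) :=
        Real.logb_lt_logb h7 (by norm_num) this
    _ = 7 := by rw [Real.logb_rpow (by norm_num) h7.ne']

/-- **The arithmetic core of HEX-KERNEL.** There is an absolute `k₁` such that for all `k ≥ k₁`, all odd `l` with `11 ≤ l ≤ 60·k`, all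
`1 ≤ N ≤ 184320·l⁴` and every `0 ≤ τ ≤ 7^{−k/l}`:
`7^{((((l−1)/2 − 1 : ℕ) + 2)·(4 + 2·log₇ N) + 1)} · τ^{((l−1)/2)²−1} < 1`. [folklore] -/
theorem core_ineq : ∃ k₁ : ℕ, ∀ (k l N : ℕ) (τ : ℝ), k₁ ≤ k → 11 ≤ l → l % 2 = 1 → (l : ℝ) ≤ 60 * k →
    1 ≤ N → N ≤ 184320 * l ^ 4 → 0 ≤ τ → τ ≤ (7 : ℝ) ^ (-((k : ℝ) / l)) →
    (7 : ℝ) ^ (((((l - 1) / 2 - 1 : ℕ) : ℝ) + 2) * (4 + 2 * Real.logb 7 N) + 1) * τ ^ (((l - 1) / 2) ^ 2 - 1) < 1 := by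
  obtain ⟨k₁, hk₁⟩ := exists_nat_forall_affine_log_le (52.25 : ℝ) 22 60 (by norm_num) (by norm_num)
  refine ⟨k₁, fun k l N τ hk h11 hodd hlk hN1 hN hτ0 hτ => ?_⟩
  -- notation and basic facts
  have h7 : (1 : ℝ) < 7 := by norm_num
  have h70 : (0 : ℝ) < 7 := by norm_num
  have hlpos : (0 : ℝ) < l := by exact_mod_cast (show 0 < l by omega)
  have hl11 : (11 : ℝ) ≤ l := by exact_mod_cast h11
  have hkR : (52.25 : ℝ) + 22 * Real.log l ≤ k := hk₁ k hk l hlpos hlk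
  -- the label: `j = (l-1)/2`, `2j = l - 1`, `j ≥ 5`
  set j : ℕ := (l - 1) / 2 with hj
  have h2j : 2 * j = l - 1 := by omega
  have hj5 : 5 ≤ j := by omega
  have hjR : (j : ℝ) = ((l : ℝ) - 1) / 2 := by
    have : ((2 * j : ℕ) : ℝ) = ((l - 1 : ℕ) : ℝ) := by exact_mod_cast h2j
    push_cast [Nat.cast_sub (show 1 ≤ l by omega)] at this
    linarith
  have hcast1 : ((((l - 1) / 2 - 1 : ℕ) : ℝ) + 2) = (j : ℝ) + 1 := by
    rw [← hj, Nat.cast_sub (show 1 ≤ j by omega)]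
    push_cast; ring
  have hcast2 : (((l - 1) / 2) ^ 2 - 1 : ℕ) = (j - 1) * (j + 1) := by
    rw [← hj]
    have : 1 ≤ j ^ 2 := Nat.one_le_pow _ _ (by omega)
    zify [this, show 1 ≤ j by omega]
    ring
  rw [hcast1, hcast2]
  -- `log₇ N < 7 + 4·log₇ l ≤ 7 + 4·log l`
  have hNR : (1 : ℝ) ≤ N := by exact_mod_cast hN1
  have hlogN : Real.logb 7 N ≤ Real.logb 7 (184320 * (l : ℝ) ^ 4) :=
    Real.logb_le_logb_of_le h7 (by linarith) (by exact_mod_cast hN)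
  have hlogN' : Real.logb 7 (184320 * (l : ℝ) ^ 4) = Real.logb 7 184320 + 4 * Real.logb 7 l := by
    rw [Real.logb_mul (by norm_num) (by positivity), Real.logb_pow]
    push_cast; ring
  have hlogl0 : 0 ≤ Real.log l := Real.log_nonneg (by linarith)
  have hlogb_le_log : Real.logb 7 l ≤ Real.log l := by
    rw [Real.logb, div_le_iff₀ (Real.log_pos h7)]
    nlinarith [one_le_log_seven]
  have hlogN7 : Real.logb 7 N < 7 + 4 * Real.log l := by
    have := logb_seven_const_lt
    linarith
  -- the key exponent inequality: `(j+1)(4 + 2 log₇ N) + 1 < (k/l)·(j−1)(j+1)`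
  have hkl : (4 : ℝ) * k / 11 ≤ (k : ℝ) / l * ((j : ℝ) - 1) := by
    -- `(j - 1) = (l - 3)/2` and `(l-3)/(2l) ≥ 4/11` for `l ≥ 11`
    rw [hjR]
    have hk0 : (0 : ℝ) ≤ k := Nat.cast_nonneg k
    rw [div_mul_eq_mul_div, le_div_iff₀ hlpos]
    nlinarith
  have hbracket : (1 : ℝ) < (k : ℝ) / l * ((j : ℝ) - 1) - (4 + 2 * Real.logb 7 N) := by
    nlinarith
  have hj1 : (1 : ℝ) ≤ (j : ℝ) + 1 := by
    have : (5 : ℝ) ≤ j := by exact_mod_cast hj5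
    linarith
  have hexp : ((j : ℝ) + 1) * (4 + 2 * Real.logb 7 N) + 1 - (k : ℝ) / l * (((j - 1 : ℕ) : ℝ) * ((j : ℝ) + 1)) < 0 := by
    rw [Nat.cast_sub (show 1 ≤ j by omega), Nat.cast_one]
    have hprod : (1 : ℝ) < ((j : ℝ) + 1) * ((k : ℝ) / l * ((j : ℝ) - 1) - (4 + 2 * Real.logb 7 N)) := by
      nlinarith
    nlinarith
  -- conclude: `7^A · τ^B ≤ 7^A · (7^{-k/l})^B = 7^{A - (k/l)·B} < 7^0 = 1`
  have hB0 : (7 : ℝ) ^ (-((k : ℝ) / l)) ≥ 0 := (Real.rpow_pos_of_pos h70 _).le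
  have hpow : τ ^ ((j - 1) * (j + 1)) ≤ ((7 : ℝ) ^ (-((k : ℝ) / l))) ^ ((j - 1) * (j + 1)) :=
    pow_le_pow_left₀ hτ0 hτ _
  have hA0 : (0 : ℝ) < (7 : ℝ) ^ (((j : ℝ) + 1) * (4 + 2 * Real.logb 7 N) + 1) := Real.rpow_pos_of_pos h70 _
  calc (7 : ℝ) ^ (((j : ℝ) + 1) * (4 + 2 * Real.logb 7 N) + 1) * τ ^ ((j - 1) * (j + 1))
      ≤ (7 : ℝ) ^ (((j : ℝ) + 1) * (4 + 2 * Real.logb 7 N) + 1) * ((7 : ℝ) ^ (-((k : ℝ) / l))) ^ ((j - 1) * (j + 1)) :=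
        mul_le_mul_of_nonneg_left hpow hA0.le
    _ = (7 : ℝ) ^ (((j : ℝ) + 1) * (4 + 2 * Real.logb 7 N) + 1 - (k : ℝ) / l * (((j - 1 : ℕ) : ℝ) * ((j : ℝ) + 1))) := by
        rw [← Real.rpow_natCast, ← Real.rpow_mul h70.le, ← Real.rpow_add h70]
        congr 1
        push_cast
        ring
    _ < (7 : ℝ) ^ (0 : ℝ) := Real.rpow_lt_rpow_of_exponent_lt h7 hexp
    _ = 1 := Real.rpow_zero 7

end Summit.ABC.IUTFork.Conditional.Hex

end
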